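import Literature.MathematicalPhysics.QuantumFieldTheory.Balaban1983to89.B9Thm311DeltaANotUnitWitness
import Literature.MathematicalPhysics.QuantumFieldTheory.Balaban1983to89.B9SectBCodedClassR
import Literature.MathematicalPhysics.QuantumFieldTheory.Balaban1983to89.B9RWSumsCompleteGeo9YNbr
import Literature.MathematicalPhysics.QuantumFieldTheory.Balaban1983to89.B9Eq335PlaquetteAtLettersY

/-!
# Balaban [B9], Thm 3.11 p. 416 («for M sufficiently large and α₀ sufficiently small») ∕ (3.35) p. 396 — THE CLASS-KEYED BUT THRESHOLD-FREE BINDER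
# «`Δ_a(U)` a unit for every (3.35)-regular `U`, EVERY `α₀`» IS NOT INHABITED at `SU(N)`: the half-frustrated background IS (3.35)-regular once `α₀` is large
# (a kernel certificate for LOCATED-18 of seat dag-n06-c g17; pub-ymgap N06, FLAG №8, director-ym №277)

T. Bałaban, *Propagators for lattice gauge theories in a background field*, Commun. Math. Phys. **99** (1985) 389–434 [`Balaban1985BackgroundPropagators`, "B9"],
(3.35) p. 396, Thm 3.1 p. 397 («for an arbitrary configuration U satisfying the regularity condition (3.35) with Mα₀ ≦ a₀»), Thm 3.11 p. 416;
T. Bałaban, *Averaging operations for lattice gauge theories*, Commun. Math. Phys. **98** (1985) 17–51 [`Balaban1985Averaging`], p. 18 (the gauge group `G = SU(N)`)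
— cited at §5 for the specialisation to `SU(N)` only (v1.1 doc-only edition: header cite added, referee ref-E g31 READ-4 r1; every declaration byte-identical to v1).

statement-level skeleton of published theorems with citation tags; proofs where landed; nothing here is a claim about the Yang–Mills mass gap

WHY THIS FILE.  Director-ym №277 ruled the frames' law `hunitA : ∀ U, G-valued U → IsUnit Δ_a(U)` vacuous at `SU(N)` (dag-n06-j's `B9Thm311DeltaANotUnitWitness`) and
named as the satisfiable shape «the CLASS-KEYED binder (U in print's class (3.35)–(3.36))».  CASCADE-R (dag-n06-c g16) and its consumer `B9SectBStepUOfMembersR` typed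
that as `∀ j α₀ U, (carrier).Reg335 c α₀ U → IsUnit Δ_a(U)` — for EVERY `α₀`.  THIS FILE is the kernel certificate that the threshold-free class-keyed binder is STILL
not inhabited at `SU(N)`, `N ≥ 2`, `d + 1 ≥ 2`: the half-frustrated background `halfCfg i (gSU N)` (values `1` and `g = diag(i, −i, 1, …, 1)`) IS in def-Y's print
class `(bg9KP (M_N ℂ) G i).Reg335 c α₀` for every `α₀ ≥ T⋆` (§3) — the gauge `u := 1` and the EXPLICIT logarithm `A := (iη)⁻¹·diag(iπ/2, −iπ/2, 0, …)` on the bonds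
where the background is `g` (else `0`) satisfy `U^u = e^{iηA}` exactly, and the two strict bounds `|A| < n·M·α₀·(Lʲη)⁻¹`, `|∇^ηA| < n·M·α₀·(Lʲη)⁻²` hold on every
class cube as soon as `c·M·α₀ ≥ (2‖log g‖ + 1)·L^{2k}` — while `Δ_a` is NOT a unit there (dag-n06-j `not_isUnit_deltaAY_halfCfg_parBY`).  Hence (§4) the negation
of the binder, at def-Y's carrier `bg9KP` for any `c > 0`, and (§5) at the CASCADE-R carrier `bg9YC (M_N ℂ) G extraYPb x` of a member (both pins), in the EXACT
shape displayed by `B9SectBStepUOfMembersR.sectBStepU_C37GY_unitary_of_members` (one member suffices).  Print's hypothesis carries the thresholds («Mα₀ ≦ a₀»,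
«α₀ sufficiently small»); the GUARDED binder of dag-n06-c g17's `B9SectBCodedChainRG1∕RG2` ∕ `B9SectBStepUGuardedR` is the inhabited reading.

WHAT IS PROVED (kernel-checked; 0 `sorry`; 2 small `def`s: the logarithm letters).
* §1 `logDiagGSU ∕ logGSU` and ★ `exp_logGSU : e^{logGSU N} = gSU N`.
* §2 `aHalf` (the `A`-field) and ★ `fluct_aHalf : e^{iη·aHalf} = halfCfg` (as units), `gaugeTr_const_one`.
* §3 ★★ `reg335P_halfCfg_of_le` — `T⋆ ≤ α₀ ⇒ (bg9KP (M_N ℂ) G i).Reg335 c α₀ (halfCfg i (gSU N))` (`gSU N ∈ G`, `0 < c`), with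
  `T⋆ := alpha0Star335 (N := N) i c = (2‖logGSU N‖ + 1)·L^{2k} ∕ (c·M)`.
* §4 ★★★ `not_forall_reg335P_isUnit_deltaAY` — `¬ ∀ α₀ U, (bg9KP (M_N ℂ) G i).Reg335 c α₀ U → IsUnit (Δ_a(U))` at the record's letters `parSymY ∕ parBY ∕ GpY`.
* §5 ★★★ `not_forall_reg335C_extraYPb_isUnit_deltaAY` — the same at `bg9YC (M_N ℂ) G extraYPb x` (a member; both pins), and ★★★ `not_hunitA_classKeyed` — the
  negation of the displayed binder `∀ j α₀ U, … → IsUnit …` over any family `f` with a member `j₀` of dimension `d + 1 ≥ 2`.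

HONEST SCOPE.  A kernel certificate about a DISPLAYED HYPOTHESIS (typing), at one background outside Thm 3.1's thresholds; it says nothing against [B9] (Theorem 3.11
holds under «Mα₀ ≦ a₀»); count-neutral; N06 NOT discharged; nothing continuum ∕ OS ∕ mass gap ∕ Clay.  Cell `pub-ymgap` (HUMAN RULING D-0062), Track A node N06 [B9],
seat `pub-ymgap-dag-n06-c` g17, 2026-08-29.  NEW file; nothing landed is modified.  Net new unproved facts: 0.
-/

noncomputable section

namespace Literature.MathematicalPhysics.QuantumFieldTheory.Balaban1983to89.B9Thm311ClassKeyedHunitANotInhabited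

open Literature.MathematicalPhysics.QuantumFieldTheory.Balaban1983to89
open Node00 B6KLevelCensusIndexV1 B9BackgroundsKLevelV1 B6GlobalChartV1 B9BackgroundsKLevelV1P
open Literature.MathematicalPhysics.QuantumFieldTheory.Balaban1983to89.B7Prop2SpecialUnitary (specialUnitaryUnits)
open Literature.MathematicalPhysics.QuantumFieldTheory.Balaban1983to89.B9Eq39Adjoint (R covD fluct)
open Literature.MathematicalPhysics.QuantumFieldTheory.Balaban1983to89.B9Eq3117Current (gaugeTr)
open Literature.MathematicalPhysics.QuantumFieldTheory.Balaban1983to89.B9Eq37Insertion (holU val_holU)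
open Literature.MathematicalPhysics.QuantumFieldTheory.Balaban1983to89.Beta.TransportVertices (holonomy holonomy_cons holonomy_nil)
open Literature.MathematicalPhysics.QuantumFieldTheory.Balaban1983to89.B9Eq335RegularityClasses (Reg335Cube)
open Literature.MathematicalPhysics.QuantumFieldTheory.Balaban1983to89.LatticeNorms (scaleLen)
open Literature.MathematicalPhysics.QuantumFieldTheory.Balaban1983to89.B9Thm311DeltaAFrustratedWitness (stairSgn)
open Literature.MathematicalPhysics.QuantumFieldTheory.Balaban1983to89.B9Thm311DeltaANotUnitWitness (halfCfg halfCfgV halfCfg_mem suDiag gSU eSU eSU_ne_zero commute_eSU_gSU eSU_mul_gSU_add_inv gSU_mem_specialUnitaryUnits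
  not_isUnit_deltaAY_halfCfg_parBY)
open Literature.MathematicalPhysics.QuantumFieldTheory.Balaban1983to89.B9PinMembersKLevelV1 (MemberY geo9Y)
open Literature.MathematicalPhysics.QuantumFieldTheory.Balaban1983to89.B9PinGeometryKLevelV1 (c35Y c35Y_pos)
open Literature.MathematicalPhysics.QuantumFieldTheory.Balaban1983to89.B9SectBCodedClassR (RegExtraY bg9YC extraYPb)
open scoped Matrix ComplexConjugate

/-! ## §1 The logarithm of the witness unit -/

section Log

variable (N : ℕ)

/-- the diagonal logarithm `(iπ/2, −iπ/2, 0, …, 0)` of `suDiag N = (i, −i, 1, …, 1)`. [cite: Balaban1985BackgroundPropagators, (3.35) p.396 («U^u = e^{iηA}»), dictionary] -/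
def logDiagGSU : Fin N → ℂ := fun j => if (j : ℕ) = 0 then (Real.pi : ℂ) / 2 * Complex.I else if (j : ℕ) = 1 then -((Real.pi : ℂ) / 2 * Complex.I) else 0

/-- `exp` of the diagonal logarithm is the witness diagonal, entrywise. [cite: Balaban1985BackgroundPropagators, (3.35) p.396, bookkeeping] -/
theorem exp_logDiagGSU (j : Fin N) : Complex.exp (logDiagGSU N j) = suDiag N j := by
  unfold logDiagGSU suDiag
  split_ifs with h0 h1
  · exact Complex.exp_pi_div_two_mul_I
  · rw [Complex.exp_neg, Complex.exp_pi_div_two_mul_I, Complex.inv_I]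
  · exact Complex.exp_zero

/-- ★ the matrix logarithm `logGSU N = diag(iπ/2, −iπ/2, 0, …)` of the witness unit. [cite: Balaban1985BackgroundPropagators, (3.35) p.396, dictionary] -/
def logGSU : Matrix (Fin N) (Fin N) ℂ := Matrix.diagonal (logDiagGSU N)

/-- ★ `e^{logGSU N} = gSU N`. [cite: Balaban1985BackgroundPropagators, (3.35) p.396 («U^u = e^{iηA}»), bookkeeping] -/
theorem exp_logGSU : NormedSpace.exp (logGSU N) = (gSU N : Matrix (Fin N) (Fin N) ℂ) := by
  rw [logGSU, Matrix.exp_diagonal]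
  show Matrix.diagonal (NormedSpace.exp (logDiagGSU N)) = Matrix.diagonal (suDiag N)
  congr 1
  funext j
  rw [Pi.coe_exp, ← Complex.exp_eq_exp_ℂ, exp_logDiagGSU]

end Log

/-! ## §2 The `A`-field of the half-frustrated background and `U^1 = e^{iηA}` -/

section Field

variable {d ℓ : ℕ} {hd : 1 ≤ d + 1} {hL : Odd (ℓ + 1) ∧ 1 < ℓ + 1} {b₀ b₁ : ℝ} {N : ℕ}
variable (i : KIdx d ℓ hd hL b₀ b₁) (η : ℝ)

/-- the `A`-field: `(iη)⁻¹·logGSU N` on the bonds where the half-frustrated background is `g`, `0` elsewhere.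
[cite: Balaban1985BackgroundPropagators, (3.35) p.396 («U^u = e^{iηA}»), dictionary] -/
def aHalf : Fin (d + 1) → Site (PV d ℓ i.m i.K hd hL) 0 → Matrix (Fin N) (Fin N) ℂ :=
  fun κ z => if stairSgn κ z = 1 then 0 else ((Complex.I * η)⁻¹ : ℂ) • logGSU N

open scoped Matrix.Norms.L2Operator

/-- the `A`-field, evaluated: on a `1`-bond it is `0`, on a `g`-bond it is `(iη)⁻¹·logGSU N`; either way its norm is at most `‖logGSU N‖·|η|⁻¹`.
[cite: Balaban1985BackgroundPropagators, (3.35) p.396, bookkeeping] -/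
theorem norm_aHalf_le (hη : η ≠ 0) (κ : Fin (d + 1)) (z : Site (PV d ℓ i.m i.K hd hL) 0) :
    ‖aHalf (N := N) i η κ z‖ ≤ ‖logGSU N‖ * |η|⁻¹ := by
  unfold aHalf
  split_ifs
  · rw [norm_zero]; positivity
  · rw [norm_smul, norm_inv, norm_mul, Complex.norm_I, one_mul, Complex.norm_real, Real.norm_eq_abs, mul_comm]

/-- ★ **`U^1 = e^{iη A}` FOR THE HALF-FRUSTRATED BACKGROUND**: `fluct η aHalf = halfCfg i (gSU N)` bond by bond (as units) — on a `1`-bond `e^{0} = 1`, on a `g`-bond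
`e^{iη·(iη)⁻¹·logGSU} = e^{logGSU} = g`. [cite: Balaban1985BackgroundPropagators, (3.35) p.396 («U^u = e^{iηA}»)] -/
theorem fluct_aHalf (hη : η ≠ 0) (κ : Fin (d + 1)) (z : Site (PV d ℓ i.m i.K hd hL) 0) :
    fluct η (aHalf (N := N) i η) κ z = halfCfg i (gSU N) κ z := by
  have hIη : (Complex.I * η : ℂ) ≠ 0 := mul_ne_zero Complex.I_ne_zero (by exact_mod_cast hη)
  apply Units.ext
  rw [fluct, val_holU, holonomy_cons, holonomy_nil, mul_one]
  unfold aHalf halfCfg halfCfgV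
  split_ifs with h
  · rw [smul_zero, NormedSpace.exp_zero, Units.val_one]
  · rw [smul_smul, mul_inv_cancel₀ hIη, one_smul, exp_logGSU]

/-- the gauge `u := 1` does nothing: `U^1 = U`. [cite: Balaban1985BackgroundPropagators, (3.28) p.395, bookkeeping] -/
theorem gaugeTr_const_one {𝔹 : Type} [Ring 𝔹] (U : Fin (d + 1) → Site (PV d ℓ i.m i.K hd hL) 0 → 𝔹ˣ) (κ : Fin (d + 1)) (z : Site (PV d ℓ i.m i.K hd hL) 0) :
    gaugeTr (shiftsV1 (PV d ℓ i.m i.K hd hL)) (fun _ => (1 : 𝔹ˣ)) U κ z = U κ z := by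
  simp [gaugeTr]

/-- the flat covariant derivative (background `1`) of the `A`-field is a difference of two values: norm at most `2‖logGSU N‖·|η|⁻¹`.
[cite: Balaban1985BackgroundPropagators, (3.3) p.390, (3.35) p.396, bookkeeping] -/
theorem norm_covD_one_aHalf_le (hη : η ≠ 0) (κ ν : Fin (d + 1)) (z : Site (PV d ℓ i.m i.K hd hL) 0) :
    ‖covD (shiftsV1 (PV d ℓ i.m i.K hd hL)) (fun _ _ => (1 : (Matrix (Fin N) (Fin N) ℂ)ˣ)) κ (aHalf (N := N) i η ν) z‖ ≤ 2 * (‖logGSU N‖ * |η|⁻¹) := by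
  rw [covD, B9Eq39Adjoint.R_def, Units.val_one, inv_one, Units.val_one, one_mul, mul_one]
  calc _ ≤ ‖aHalf (N := N) i η ν (shiftsV1 (PV d ℓ i.m i.K hd hL) κ z)‖ + ‖aHalf (N := N) i η ν z‖ := norm_sub_le _ _
    _ ≤ ‖logGSU N‖ * |η|⁻¹ + ‖logGSU N‖ * |η|⁻¹ := add_le_add (norm_aHalf_le i η hη ν _) (norm_aHalf_le i η hη ν z)
    _ = _ := by ring

end Field

/-! ## §3 ★★ The half-frustrated background IS (3.35)-regular once `α₀` is large -/

section Regular

open scoped Matrix.Norms.L2Operator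

variable {d ℓ : ℕ} {hd : 1 ≤ d + 1} {hL : Odd (ℓ + 1) ∧ 1 < ℓ + 1} {b₀ b₁ : ℝ} {N : ℕ}

/-- **THE THRESHOLD** `T⋆ = (2‖logGSU N‖ + 1)·L^{2k} ∕ (c·M)` above which the half-frustrated background is in the class at threshold `c`.
[cite: Balaban1985BackgroundPropagators, (3.35) p.396 (bookkeeping: a witness)] -/
def alpha0Star335 (i : KIdx d ℓ hd hL b₀ b₁) (c : ℝ) : ℝ := (2 * ‖logGSU N‖ + 1) * (kGeo i).L ^ (2 * i.k) / (c * (kGeo i).M)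

/-- `0 < T⋆` for `0 < c`. [cite: Balaban1985BackgroundPropagators, (3.35) p.396, bookkeeping] -/
theorem alpha0Star335_pos (i : KIdx d ℓ hd hL b₀ b₁) {c : ℝ} (hc : 0 < c) : 0 < alpha0Star335 (N := N) i c := by
  unfold alpha0Star335
  have hM : 0 < (kGeo i).M := lt_of_lt_of_le (by norm_num : (0 : ℝ) < 8) (B9RWSumsCompleteGeo9YNbr.eight_le_M_geo9K i)
  have hL : (1 : ℝ) ≤ (kGeo i).L := B9Eq335PlaquetteAtLettersY.one_le_L i
  have : 0 < (kGeo i).L ^ (2 * i.k) := pow_pos (by linarith) _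
  positivity


/-- ★★ **THE HALF-FRUSTRATED `SU(N)` BACKGROUND IS (3.35)-REGULAR AT EVERY `α₀ ≥ T⋆`** (def-Y's print class `bg9KP`, any threshold `c > 0`, any `G ∋ gSU N`,
`N ≥ 1`): on every class cube take the gauge `u := 1` and the `A`-field `aHalf` (§2): `U^u = e^{iηA}` exactly, and the two strict bounds
`‖A‖ < n·(M·α₀)·(Lʲη)⁻¹`, `‖η⁻¹∇A‖ < n·(M·α₀)·(Lʲη)⁻²` follow from `‖A‖ ≤ ‖logGSU N‖·η⁻¹`, `1 ≤ j ≤ k`, `c ≤ n` and `c·M·α₀ ≥ (2‖logGSU N‖+1)·L^{2k}`.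
[cite: Balaban1985BackgroundPropagators, (3.35) p.396, Thm 3.1 p.397 («with Mα₀ ≦ a₀» — the threshold the display omits)] -/
theorem reg335P_halfCfg_of_le (i : KIdx d ℓ hd hL b₀ b₁) [Nonempty (Fin N)] {G : Subgroup (Matrix (Fin N) (Fin N) ℂ)ˣ} (hg : gSU N ∈ G) {c : ℝ} (hc : 0 < c)
    {α₀ : ℝ} (hα : alpha0Star335 (N := N) i c ≤ α₀) :
    (bg9KP (Matrix (Fin N) (Fin N) ℂ) G i).Reg335 c α₀ (halfCfg i (gSU N)) := by
  have hM : 0 < (kGeo i).M := lt_of_lt_of_le (by norm_num : (0 : ℝ) < 8) (B9RWSumsCompleteGeo9YNbr.eight_le_M_geo9K i)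
  have hL1 : (1 : ℝ) ≤ (kGeo i).L := B9Eq335PlaquetteAtLettersY.one_le_L i
  have hη : 0 < (kGeo i).eta := B9Eq335PlaquetteAtLettersY.eta_pos i
  have hηne : (kGeo i).eta ≠ 0 := ne_of_gt hη
  set B : ℝ := ‖logGSU N‖ with hB
  have hB0 : 0 ≤ B := norm_nonneg _
  -- the threshold, unfolded: `(2B+1)·L^{2k} ≤ c·M·α₀`
  have hT : (2 * B + 1) * (kGeo i).L ^ (2 * i.k) ≤ c * (kGeo i).M * α₀ := by
    have h := (div_le_iff₀ (by positivity : (0 : ℝ) < c * (kGeo i).M)).1 hα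
    linarith [h]
  refine (reg335P_iff (𝔸 := Matrix (Fin N) (Fin N) ℂ) (G := G) i c α₀ _).2 ⟨fun μ x => halfCfg_mem i (gSU N) hg μ x, ?_⟩
  rintro ⟨cube, j, n⟩ hq
  obtain ⟨hj1, hjk, hcn, -, -, -⟩ := (mem_cubeClassP_iff i c cube j n).1 hq
  dsimp only
  -- the per-cube constant dominates: `n·(M·α₀) ≥ c·M·α₀ ≥ (2B+1)·L^{2k}`
  have hα0 : 0 ≤ α₀ := (alpha0Star335_pos (N := N) i hc).le.trans hα
  have hC : (2 * B + 1) * (kGeo i).L ^ (2 * i.k) ≤ (n : ℝ) * ((kGeo i).M * α₀) := by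
    calc (2 * B + 1) * (kGeo i).L ^ (2 * i.k) ≤ c * (kGeo i).M * α₀ := hT
      _ = c * ((kGeo i).M * α₀) := by ring
      _ ≤ (n : ℝ) * ((kGeo i).M * α₀) := mul_le_mul_of_nonneg_right hcn (mul_nonneg hM.le hα0)
  have hLj : (1 : ℝ) ≤ (kGeo i).L ^ j := one_le_pow₀ hL1
  have hLj2k : (kGeo i).L ^ j ≤ (kGeo i).L ^ (2 * i.k) := pow_le_pow_right₀ hL1 (by omega)
  have hL2j2k : (kGeo i).L ^ (2 * j) ≤ (kGeo i).L ^ (2 * i.k) := pow_le_pow_right₀ hL1 (by omega)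
  refine ⟨fun _ => 1, aHalf (N := N) i (kGeo i).eta, fun z _ => ?_, fun κ z _ => ?_, fun κ z _ => ?_, fun κ ν z _ => ?_⟩
  · simp
  · rw [gaugeTr_const_one, fluct_aHalf i _ hηne]
  · -- `‖A‖ ≤ B/η < n(Mα₀)/(Lʲη)`
    have hA := norm_aHalf_le (N := N) i (kGeo i).eta hηne κ z
    rw [abs_of_pos hη] at hA
    refine lt_of_le_of_lt hA ?_
    rw [scaleLen, mul_inv, ← mul_assoc]
    refine mul_lt_mul_of_pos_right ?_ (inv_pos.2 hη)
    rw [lt_mul_inv_iff₀ (lt_of_lt_of_le one_pos hLj)]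
    calc B * (kGeo i).L ^ j ≤ B * (kGeo i).L ^ (2 * i.k) := mul_le_mul_of_nonneg_left hLj2k hB0
      _ < (2 * B + 1) * (kGeo i).L ^ (2 * i.k) := by nlinarith [lt_of_lt_of_le one_pos (hLj.trans hLj2k)]
      _ ≤ _ := hC
  · -- `‖η⁻¹∇A‖ ≤ 2B/η² < n(Mα₀)/(Lʲη)²`
    have hD := norm_covD_one_aHalf_le (N := N) i (kGeo i).eta hηne κ ν z
    rw [abs_of_pos hη] at hD
    rw [norm_smul, norm_inv, Complex.norm_real, Real.norm_eq_abs, abs_of_pos hη]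
    have h2 : (kGeo i).eta⁻¹ * ‖covD (shiftsV1 (PV d ℓ i.m i.K hd hL)) (fun _ _ => (1 : (Matrix (Fin N) (Fin N) ℂ)ˣ)) κ (aHalf (N := N) i (kGeo i).eta ν) z‖
        ≤ (kGeo i).eta⁻¹ * (2 * (B * (kGeo i).eta⁻¹)) := mul_le_mul_of_nonneg_left hD (inv_nonneg.2 hη.le)
    refine lt_of_le_of_lt h2 ?_
    have hξ : 0 < (kGeo i).L ^ j := lt_of_lt_of_le one_pos hLj
    rw [scaleLen, show (kGeo i).eta⁻¹ * (2 * (B * (kGeo i).eta⁻¹)) = (2 * B) * ((kGeo i).eta ^ 2)⁻¹ by field_simp,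
      show ((kGeo i).L ^ j * (kGeo i).eta) ^ 2 = (kGeo i).L ^ (2 * j) * (kGeo i).eta ^ 2 by ring, mul_inv, ← mul_assoc]
    refine mul_lt_mul_of_pos_right ?_ (inv_pos.2 (pow_pos hη 2))
    rw [lt_mul_inv_iff₀ (pow_pos (lt_of_lt_of_le one_pos hL1) _)]
    calc 2 * B * (kGeo i).L ^ (2 * j) ≤ 2 * B * (kGeo i).L ^ (2 * i.k) := mul_le_mul_of_nonneg_left hL2j2k (by positivity)
      _ < (2 * B + 1) * (kGeo i).L ^ (2 * i.k) := by nlinarith [pow_pos (lt_of_lt_of_le one_pos hL1) (2 * i.k)]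
      _ ≤ _ := hC

/-- … in particular at `α₀ := T⋆`. [cite: Balaban1985BackgroundPropagators, (3.35) p.396] -/
theorem reg335P_halfCfg_tStar (i : KIdx d ℓ hd hL b₀ b₁) [Nonempty (Fin N)] {G : Subgroup (Matrix (Fin N) (Fin N) ℂ)ˣ} (hg : gSU N ∈ G) {c : ℝ} (hc : 0 < c) :
    (bg9KP (Matrix (Fin N) (Fin N) ℂ) G i).Reg335 c (alpha0Star335 (N := N) i c) (halfCfg i (gSU N)) :=
  reg335P_halfCfg_of_le i hg hc le_rfl

end Regular

/-! ## §4 ★★★ The threshold-free class-keyed `hunitA` is not inhabited (def-Y's carrier) -/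

section NotInhabited

open scoped Matrix.Norms.L2Operator

variable {d ℓ : ℕ} {hd : 1 ≤ d + 1} {hL : Odd (ℓ + 1) ∧ 1 < ℓ + 1} {b₀ b₁ : ℝ} {N : ℕ}
variable (i : KIdx d ℓ hd hL b₀ b₁)

/-- ★★★ **«`Δ_a(U)` IS A UNIT FOR EVERY (3.35)-REGULAR `U`, EVERY `α₀`» IS FALSE AT `SU(N)`** (`N ≥ 2`, `d + 1 ≥ 2`, any `G ∋ gSU N`, any threshold `c > 0`,
the record's letters `parSymY ∕ parBY ∕ GpY`): the half-frustrated background is regular at `α₀ := T⋆` (§3) and `Δ_a` is not a unit there (dag-n06-j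
`not_isUnit_deltaAY_halfCfg_parBY`). [cite: Balaban1985BackgroundPropagators, Thm 3.11 p.416 («for M sufficiently large and α₀ sufficiently small»), (3.35) p.396] -/
theorem not_forall_reg335P_isUnit_deltaAY (hd1 : 1 ≤ d) (hN : 2 ≤ N) {G : Subgroup (Matrix (Fin N) (Fin N) ℂ)ˣ} (hg : gSU N ∈ G) {c : ℝ} (hc : 0 < c) :
    ¬ ∀ (α₀ : ℝ) (U : CfgY (Matrix (Fin N) (Fin N) ℂ) i), (bg9KP (Matrix (Fin N) (Fin N) ℂ) G i).Reg335 c α₀ U →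
      IsUnit (deltaAY i (parSymY i) (parBY i) (GpY i (parSymY i)) U) := by
  haveI : Nonempty (Fin N) := ⟨⟨0, by omega⟩⟩
  intro h
  exact not_isUnit_deltaAY_halfCfg_parBY i hd1 (eSU_ne_zero (by omega)) commute_eSU_gSU eSU_mul_gSU_add_inv (parSymY i) (GpY i (parSymY i))
    (h _ _ (reg335P_halfCfg_tStar i hg hc))

end NotInhabited

/-! ## §5 ★★★ … and at the CASCADE-R carrier `bg9YC (M_N ℂ) G extraYPb x` of a member — the exact binder of `sectBStepU_C37GY_unitary_of_members` -/

section Member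

open scoped Matrix.Norms.L2Operator

variable {d ℓ : ℕ} {hd : 1 ≤ d + 1} {hL : Odd (ℓ + 1) ∧ 1 < ℓ + 1} {b₀ b₁ : ℝ} {Mstar N : ℕ}

/-- ★★ **THE HALF-FRUSTRATED BACKGROUND IS IN THE CLASS-PARAMETRIC CARRIER's (3.35) CLASS AT THE RECORD's READING OF PRINT's CLASS** (`P := extraYPb`, BOTH pins,
threshold `c35Y = 10` inside, the slot `c` inert) for every `α₀ ≥ max (T⋆ at the first pin) (T⋆ at the second pin)`.
[cite: Balaban1985BackgroundPropagators, (3.35) p.396, Thm 3.14 pp.426–427 (the two sequences)] -/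
theorem reg335C_extraYPb_halfCfg_of_le (x : MemberY d ℓ hd hL b₀ b₁ Mstar) [Nonempty (Fin N)] {G : Subgroup (Matrix (Fin N) (Fin N) ℂ)ˣ} (hg : gSU N ∈ G)
    (c : ℝ) {α₀ : ℝ} (hα : max (alpha0Star335 (N := N) x.toKIdx c35Y) (alpha0Star335 (N := N) x.snd c35Y) ≤ α₀) :
    (bg9YC (Matrix (Fin N) (Fin N) ℂ) G (extraYPb (d := d) (ℓ := ℓ) (hd := hd) (hL := hL) (b₀ := b₀) (b₁ := b₁) (Mstar := Mstar)
      (Matrix (Fin N) (Fin N) ℂ) G) x).Reg335 c α₀ (halfCfg x.toKIdx (gSU N)) := by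
  have h1 := reg335P_halfCfg_of_le (N := N) x.toKIdx hg c35Y_pos ((le_max_left _ _).trans hα)
  have h2 := reg335P_halfCfg_of_le (N := N) x.snd hg c35Y_pos ((le_max_right _ _).trans hα)
  have hα0 : 0 ≤ α₀ := ((alpha0Star335_pos (N := N) x.toKIdx c35Y_pos).le.trans (le_max_left _ _)).trans hα
  exact ⟨⟨h1.1, hα0, h1.2⟩, h2⟩

/-- ★★★ **THE CLASS-KEYED, THRESHOLD-FREE `hunitA` OF CASCADE-R IS NOT INHABITED AT `SU(N)` — ONE MEMBER** (`N ≥ 2`, `d + 1 ≥ 2`, any `G ∋ gSU N`, e.g.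
`G = SU(N)`; the record's letters `parSymY ∕ parBY ∕ GpY`; carrier `bg9YC (M_N ℂ) G extraYPb x`, the slot `c35` inert).
[cite: Balaban1985BackgroundPropagators, Thm 3.11 p.416 («for M sufficiently large and α₀ sufficiently small»), Thm 3.1 p.397 («with Mα₀ ≦ a₀»), (3.35) p.396] -/
theorem not_forall_reg335C_extraYPb_isUnit_deltaAY (x : MemberY d ℓ hd hL b₀ b₁ Mstar) (hd1 : 1 ≤ d) (hN : 2 ≤ N)
    {G : Subgroup (Matrix (Fin N) (Fin N) ℂ)ˣ} (hg : gSU N ∈ G) (c35 : ℝ) :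
    ¬ ∀ (α₀ : ℝ) (U : CfgY (Matrix (Fin N) (Fin N) ℂ) x.toKIdx),
      (bg9YC (Matrix (Fin N) (Fin N) ℂ) G (extraYPb (d := d) (ℓ := ℓ) (hd := hd) (hL := hL) (b₀ := b₀) (b₁ := b₁) (Mstar := Mstar)
        (Matrix (Fin N) (Fin N) ℂ) G) x).Reg335 c35 α₀ U →
      IsUnit (deltaAY x.toKIdx (parSymY x.toKIdx) (parBY x.toKIdx) (GpY x.toKIdx (parSymY x.toKIdx)) U) := by
  haveI : Nonempty (Fin N) := ⟨⟨0, by omega⟩⟩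
  intro h
  exact not_isUnit_deltaAY_halfCfg_parBY x.toKIdx hd1 (eSU_ne_zero (by omega)) commute_eSU_gSU eSU_mul_gSU_add_inv (parSymY x.toKIdx)
    (GpY x.toKIdx (parSymY x.toKIdx)) (h _ _ (reg335C_extraYPb_halfCfg_of_le (N := N) x hg c35 le_rfl))

/-- ★★★ **THE DISPLAYED BINDER `hunitA` OF `B9SectBStepUOfMembersR.sectBStepU_C37GY_unitary_of_members` (and of every CASCADE-R frame) AT `P := extraYPb`,
NEGATED, VERBATIM SHAPE** — over any family `f` with ONE member `j₀` (`N ≥ 2`, `d + 1 ≥ 2`, `G ∋ gSU N`).  The GUARDED binder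
(`MInv ≤ M → 0 < α₀ → M·α₀ ≤ aInv → …`, dag-n06-c g17 `B9SectBStepUGuardedR`) is the inhabited reading.
[cite: Balaban1985BackgroundPropagators, Thm 3.11 p.416, Thm 3.1 p.397, (3.35) p.396] -/
theorem not_hunitA_classKeyed {J : Type} (f : J → MemberY d ℓ hd hL b₀ b₁ Mstar) (j₀ : J) (hd1 : 1 ≤ d) (hN : 2 ≤ N)
    {G : Subgroup (Matrix (Fin N) (Fin N) ℂ)ˣ} (hg : gSU N ∈ G) (c35 : ℝ) :
    ¬ ∀ (j : J) (α₀ : ℝ) (U : CfgY (Matrix (Fin N) (Fin N) ℂ) (f j).toKIdx),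
      (bg9YC (Matrix (Fin N) (Fin N) ℂ) G (extraYPb (d := d) (ℓ := ℓ) (hd := hd) (hL := hL) (b₀ := b₀) (b₁ := b₁) (Mstar := Mstar)
        (Matrix (Fin N) (Fin N) ℂ) G) (f j)).Reg335 c35 α₀ U →
      IsUnit (deltaAY (f j).toKIdx (parSymY (f j).toKIdx) (parBY (f j).toKIdx) (GpY (f j).toKIdx (parSymY (f j).toKIdx)) U) :=
  fun h => not_forall_reg335C_extraYPb_isUnit_deltaAY (N := N) (f j₀) hd1 hN hg c35 (h j₀)

/-- … in particular for `G = SU(N)`. [cite: Balaban1985BackgroundPropagators, Thm 3.11 p.416; Balaban1985Averaging, p.18 (G = SU(N))] -/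
theorem not_hunitA_classKeyed_su {J : Type} (f : J → MemberY d ℓ hd hL b₀ b₁ Mstar) (j₀ : J) (hd1 : 1 ≤ d) (hN : 2 ≤ N) (c35 : ℝ) :
    ¬ ∀ (j : J) (α₀ : ℝ) (U : CfgY (Matrix (Fin N) (Fin N) ℂ) (f j).toKIdx),
      (bg9YC (Matrix (Fin N) (Fin N) ℂ) (specialUnitaryUnits (Fin N)) (extraYPb (d := d) (ℓ := ℓ) (hd := hd) (hL := hL) (b₀ := b₀) (b₁ := b₁)
        (Mstar := Mstar) (Matrix (Fin N) (Fin N) ℂ) (specialUnitaryUnits (Fin N))) (f j)).Reg335 c35 α₀ U →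
      IsUnit (deltaAY (f j).toKIdx (parSymY (f j).toKIdx) (parBY (f j).toKIdx) (GpY (f j).toKIdx (parSymY (f j).toKIdx)) U) :=
  not_hunitA_classKeyed (N := N) f j₀ hd1 hN (gSU_mem_specialUnitaryUnits hN) c35

end Member

end Literature.MathematicalPhysics.QuantumFieldTheory.Balaban1983to89.B9Thm311ClassKeyedHunitANotInhabited

end
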